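import Summits.Ventures.PackingBounds.Energy.TenPointCkFiveDefs
import HarnessLib

/-!
# `TenPointCkFive`: the value of the bound `10(9c - F(1,1,1) - A(1)) = 1015/8`

Framing: lottery ticket; floor = certified bounds/negative ranges. Venture `PackingBounds`, cell
`pub-packcert`, energy family E3PT (pub-packcert-energy gen 14; n = 4 kernel route = KERNEL-D6 data route + `threePointF 4`).
-/

noncomputable section

namespace Summit.Ventures.PackingBounds.Energy.TenPointCkFive

set_option maxRecDepth 20000 in
set_option maxHeartbeats 400000000 in
/-- The value of the bound: `10(9c - F(1,1,1) - A(1)) = 1015/8` (the `(1+t)^5`-energy of the configuration 'two orthogonal regular pentagons (4,10)' over ordered pairs). -/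
theorem bound_eqW5 : (10 : ℝ) * ((10 - 1) * c0KW5 - FexpKW5 1 1 1 - aPolyKW5 1) = ((1015 : ℝ)/8) := by
  unfold c0KW5 FexpKW5 aPolyKW5; ring

end Summit.Ventures.PackingBounds.Energy.TenPointCkFive
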